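import Summits.CriticalPhenomena.PercolationContinuityZ3.Theorems.PercNearOneGluingNoHeavyLowerTailAntitheticTwinTop
import HarnessLib

/-!
# `NoHeavyLowerTail` (stmt-CriticalPhenomena-4575) — antithetic cluster pairs: **THE TOP EVENT AT A VERTEX DOMINATING THE SOURCE — BOXES**
# (red–red part and cross part; prim-hp-2 gen 73, HOME/THEOREM-TW.md §3bis)

Support file (`--supports stmt-CriticalPhenomena-4575`, hull-port prover `prim-hp-2`, gen 73).  No definitions, no named facts, no sorries;
standard axioms.  Notation of …AntitheticTwinTop: colourings `T ⊆ Sym2 V`, `X T = openCluster (T ∩ E) s`, `Y T = openCluster (Tᶜ ∩ E) s`,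
`K`-form kernels.  `P` DOMINATES the source: every neighbour of `s` (other than `P`) is a neighbour of `P` (`hdom`; twins are the symmetric
case).  On the top event `{P ∈ X T, P ∉ Y T}` every neighbour `v` of `s` has type RR/RB/BR (colours of `sv`, `Pv`) and lies in `X T`.
Generalising …AntitheticTwinTop / …AntitheticTwinTopConnected: the PRIVATE pairs of `P` are left FREE in every box (a blue antipode-path that
uses one is red there in the partner), so only `N(s) ⊆ N(P)` is needed.
* `Antithetic.Dom.dom_of_agree` — red domination of the boxes fixing the pairs at `s`, the pairs `Pv` (`v ∈ N(s)`), and leaving everything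
  else (including a set `C` of pairs inside `N(s)`, on which nothing is assumed) to be flipped.
* `Antithetic.Dom.top_rr_sum_nonneg` — `Σ_{top, some v ∈ N(s) red–red} K₁K₂ ≥ 0`.
* `Antithetic.Dom.top_cross_sum_nonneg` — `Σ_{top, no red–red, some red E-pair jk with sj blue, sk red} K₁K₂ ≥ 0` (on the top event such a
  pair is automatically red: `Dom.cross_red_of_top`).
The rest of the top event and THEOREM TXG are in …AntitheticDomTop.
[cite: VandenbergHaggstromKahn2005, §1 p. 6 ("Harris' inequality"), §1 p. 3 (open cluster `C_s`)]
-/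

noncomputable section

namespace Summit.CriticalPhenomena.PercolationContinuityZ3.Theorems

open Literature.Probability.Percolation
open scoped Classical

namespace Antithetic

namespace Dom

variable {V : Type*}

section Clusters

variable {E : Set (Sym2 V)} {s P : V}

/-- A red–red neighbour of `s` (adjacent to `P` by domination) puts `P` into the red cluster. [this work] -/
theorem mem_red_of_rr (hdom : ∀ v, v ≠ s → v ≠ P → s(s, v) ∈ E → s(P, v) ∈ E) {T : Set (Sym2 V)} {v : V}
    (hvs : v ≠ s) (hvP : v ≠ P) (hvE : s(s, v) ∈ E) (hsv : s(s, v) ∈ T) (hPv : s(P, v) ∈ T) :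
    P ∈ openCluster (T ∩ E) s := by
  have hv : v ∈ openCluster (T ∩ E) s := Twin.mem_red_of_pair (mem_openCluster_self _ s) hsv hvE hvs.symm
  exact Twin.mem_red_of_pair hv (by rw [Sym2.eq_swap]; exact hPv) (by rw [Sym2.eq_swap]; exact hdom v hvs hvP hvE) hvP

/-- On the top event no neighbour of `s` is blue–blue. [this work] -/
theorem noBB_of_top (hdom : ∀ v, v ≠ s → v ≠ P → s(s, v) ∈ E → s(P, v) ∈ E) {T : Set (Sym2 V)}
    (hPY : P ∉ openCluster (Tᶜ ∩ E) s) {v : V} (hvs : v ≠ s) (hvP : v ≠ P) (hvE : s(s, v) ∈ E) :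
    s(s, v) ∈ T ∨ s(P, v) ∈ T := by
  by_contra h
  have h1 : s(s, v) ∉ T := fun h' => h (Or.inl h')
  have h2 : s(P, v) ∉ T := fun h' => h (Or.inr h')
  have hv : v ∈ openCluster (Tᶜ ∩ E) s := Twin.mem_blue_of_pair (mem_openCluster_self _ s) h1 hvE hvs.symm
  exact hPY (Twin.mem_blue_of_pair hv (by rw [Sym2.eq_swap]; exact h2) (by rw [Sym2.eq_swap]; exact hdom v hvs hvP hvE) hvP)

/-- On the top event every neighbour of `s` lies in the red cluster. [this work] -/
theorem nbr_mem_red_of_top (hdom : ∀ v, v ≠ s → v ≠ P → s(s, v) ∈ E → s(P, v) ∈ E) {T : Set (Sym2 V)}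
    (hPX : P ∈ openCluster (T ∩ E) s) (hPY : P ∉ openCluster (Tᶜ ∩ E) s) {v : V} (hvs : v ≠ s) (hvP : v ≠ P)
    (hvE : s(s, v) ∈ E) : v ∈ openCluster (T ∩ E) s := by
  rcases noBB_of_top hdom hPY hvs hvP hvE with h | h
  · exact Twin.mem_red_of_pair (mem_openCluster_self _ s) h hvE hvs.symm
  · exact Twin.mem_red_of_pair hPX h (hdom v hvs hvP hvE) hvP.symm

/-- On the top event an `E`-pair between a blue-`s` neighbour `j` and a red-`s`, blue-`P` neighbour `k` is red. [this work] -/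
theorem cross_red_of_top (hdom : ∀ v, v ≠ s → v ≠ P → s(s, v) ∈ E → s(P, v) ∈ E) {T : Set (Sym2 V)}
    (hPY : P ∉ openCluster (Tᶜ ∩ E) s) {j k : V} (hjs : j ≠ s) (hks : k ≠ s) (hkP : k ≠ P)
    (hjE : s(s, j) ∈ E) (hkE : s(s, k) ∈ E) (hsj : s(s, j) ∉ T) (hPk : s(P, k) ∉ T) (hjkE : s(j, k) ∈ E) (hjk : j ≠ k) :
    s(j, k) ∈ T := by
  by_contra h
  have hj : j ∈ openCluster (Tᶜ ∩ E) s := Twin.mem_blue_of_pair (mem_openCluster_self _ s) hsj hjE hjs.symm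
  have hk : k ∈ openCluster (Tᶜ ∩ E) s := Twin.mem_blue_of_pair hj h hjkE hjk
  exact hPY (Twin.mem_blue_of_pair hk (by rw [Sym2.eq_swap]; exact hPk) (by rw [Sym2.eq_swap]; exact hdom k hks hkP hkE) hkP)

/-- **Red domination of the generalised boxes.**  `T, T'` agree on the pairs at `s` and on the pairs `Pv` (`v` a neighbour of `s`), and are
opposite off these pairs and off a further set `C` of pairs joining two neighbours of `s` (on `C` nothing is required); in `T`: `P ∈ X T` and
no neighbour of `s` is blue–blue.  Then `Y T' ⊆ X T`. [this work] -/
theorem dom_of_agree (hdom : ∀ v, v ≠ s → v ≠ P → s(s, v) ∈ E → s(P, v) ∈ E) {T T' : Set (Sym2 V)} (C : Set (Sym2 V))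
    (hC : ∀ e ∈ C, ∃ j k, e = s(j, k) ∧ j ≠ s ∧ j ≠ P ∧ s(s, j) ∈ E ∧ k ≠ s ∧ k ≠ P ∧ s(s, k) ∈ E)
    (hagree_s : ∀ w, (s(s, w) ∈ T' ↔ s(s, w) ∈ T))
    (hagree_P : ∀ v, v ≠ s → v ≠ P → s(s, v) ∈ E → (s(P, v) ∈ T' ↔ s(P, v) ∈ T))
    (hflip : ∀ e : Sym2 V, s ∉ e → (¬ ∃ v, v ≠ s ∧ v ≠ P ∧ s(s, v) ∈ E ∧ e = s(P, v)) → e ∉ C → (e ∈ T' ↔ e ∉ T))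
    (hPX : P ∈ openCluster (T ∩ E) s)
    (hnoBB : ∀ v, v ≠ s → v ≠ P → s(s, v) ∈ E → s(s, v) ∈ T ∨ s(P, v) ∈ T) :
    openCluster (T'ᶜ ∩ E) s ⊆ openCluster (T ∩ E) s := by
  have hN : ∀ v, v ≠ s → v ≠ P → s(s, v) ∈ E → v ∈ openCluster (T ∩ E) s := by
    intro v hvs hvP hvE
    rcases hnoBB v hvs hvP hvE with h | h
    · exact Twin.mem_red_of_pair (mem_openCluster_self _ s) h hvE hvs.symm
    · exact Twin.mem_red_of_pair hPX h (hdom v hvs hvP hvE) hvP.symm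
  refine TwoStage.Fan.cluster_subset_of_closed (mem_openCluster_self _ s) fun u w hu huw => ?_
  obtain ⟨⟨hT', hE⟩, hne⟩ := (openGraph_adj _ u w).1 huw
  by_cases hws : w = s
  · rw [hws]; exact mem_openCluster_self _ s
  by_cases hwP : w = P
  · rw [hwP]; exact hPX
  by_cases hsu : s ∈ s(u, w)
  · -- a pair at `s`: `u = s`, `w` a neighbour of `s`
    have hus : u = s := by
      rcases Sym2.mem_iff.1 hsu with h | h
      · exact h.symm
      · exact absurd h.symm hws
    subst hus
    exact hN w hws hwP hE
  by_cases hPv : ∃ v, v ≠ s ∧ v ≠ P ∧ s(s, v) ∈ E ∧ s(u, w) = s(P, v)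
  · obtain ⟨v, hvs, hvP, hvE, huv⟩ := hPv
    rcases Sym2.eq_iff.1 huv with ⟨-, hw⟩ | ⟨hu', hw⟩
    · rw [hw]; exact hN v hvs hvP hvE
    · exact absurd hw hwP
  by_cases hCe : s(u, w) ∈ C
  · obtain ⟨j, k, hejk, hjs, hjP, hjE, hks, hkP, hkE⟩ := hC _ hCe
    rcases Sym2.eq_iff.1 hejk with ⟨-, hw⟩ | ⟨-, hw⟩
    · rw [hw]; exact hN k hks hkP hkE
    · rw [hw]; exact hN j hjs hjP hjE
  · -- a free pair: blue in `T'` means red in `T`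
    have hTr : s(u, w) ∈ T := by
      by_contra h
      exact hT' ((hflip _ hsu hPv hCe).2 h)
    exact Twin.mem_red_of_pair hu hTr hE hne

end Clusters

variable [Fintype V]

/-- **The red–red part of the top event at a vertex dominating the source (`K`-form).** [this work] -/
theorem top_rr_sum_nonneg (E : Set (Sym2 V)) (s P : V) (hdom : ∀ v, v ≠ s → v ≠ P → s(s, v) ∈ E → s(P, v) ∈ E)
    {K₁ K₂ : Set V → Set V → ℝ}
    (hK₁ : ∀ ⦃A A' B B' : Set V⦄, A ⊆ A' → B' ⊆ B → K₁ A B ≤ K₁ A' B') (hso₁ : ∀ A B, 0 ≤ K₁ A B + K₁ B A)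
    (hK₂ : ∀ ⦃A A' B B' : Set V⦄, A ⊆ A' → B' ⊆ B → K₂ A B ≤ K₂ A' B') (hso₂ : ∀ A B, 0 ≤ K₂ A B + K₂ B A) :
    0 ≤ ∑ T ∈ Finset.univ.filter (fun T : Set (Sym2 V) => P ∈ openCluster (T ∩ E) s ∧ P ∉ openCluster (Tᶜ ∩ E) s ∧
        ∃ v, v ≠ s ∧ v ≠ P ∧ s(s, v) ∈ E ∧ s(s, v) ∈ T ∧ s(P, v) ∈ T),
      K₁ (openCluster (T ∩ E) s) (openCluster (Tᶜ ∩ E) s) * K₂ (openCluster (T ∩ E) s) (openCluster (Tᶜ ∩ E) s) := by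
  -- fixed pairs: all pairs at `s` and the pairs `Pv`, `v` a neighbour of `s`
  let A : Set (Sym2 V) := {e | s ∈ e ∨ ∃ v, v ≠ s ∧ v ≠ P ∧ s(s, v) ∈ E ∧ e = s(P, v)}
  let good : Set (Sym2 V) → Prop := fun N =>
    (∃ v, v ≠ s ∧ v ≠ P ∧ s(s, v) ∈ E ∧ s(s, v) ∈ N ∧ s(P, v) ∈ N) ∧
    (∀ v, v ≠ s → v ≠ P → s(s, v) ∈ E → s(s, v) ∈ N ∨ s(P, v) ∈ N)
  have hsA : ∀ v, s(s, v) ∈ A := fun v => Or.inl (Sym2.mem_mk_left s v)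
  have hPA : ∀ v, v ≠ s → v ≠ P → s(s, v) ∈ E → s(P, v) ∈ A := fun v hvs hvP hvE => Or.inr ⟨v, hvs, hvP, hvE, rfl⟩
  have hgood_iff : ∀ N M : Set (Sym2 V), (∀ e ∈ A, (e ∈ M ↔ e ∈ N)) → (good N ↔ good M) := by
    intro N M h
    constructor
    · rintro ⟨⟨v, hvs, hvP, hvE, h1, h2⟩, hno⟩
      exact ⟨⟨v, hvs, hvP, hvE, (h _ (hsA v)).2 h1, (h _ (hPA v hvs hvP hvE)).2 h2⟩,
        fun v hvs hvP hvE => (hno v hvs hvP hvE).imp (h _ (hsA v)).2 (h _ (hPA v hvs hvP hvE)).2⟩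
    · rintro ⟨⟨v, hvs, hvP, hvE, h1, h2⟩, hno⟩
      exact ⟨⟨v, hvs, hvP, hvE, (h _ (hsA v)).1 h1, (h _ (hPA v hvs hvP hvE)).1 h2⟩,
        fun v hvs hvP hvE => (hno v hvs hvP hvE).imp (h _ (hsA v)).1 (h _ (hPA v hvs hvP hvE)).1⟩
  let C := {N : Set (Sym2 V) // N ⊆ A ∧ good N}
  let D : Finset (Set (Sym2 V)) := Finset.univ.filter fun T => good T
  have hfreeze := Box.freeze_boxes_sum_nonneg E s D (fun _ : C => A) (fun c : C => c.1)
    (fun T hT => ?_) (fun c T hT => ?_) (fun c c' T hc hc' => ?_) (fun c T T' hT hT' hflip => ?_) {P} hK₁ hso₁ hK₂ hso₂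
  · have hev : D.filter (fun T => ∀ Q ∈ ({P} : Set V), Q ∉ openCluster (Tᶜ ∩ E) s) =
        Finset.univ.filter (fun T : Set (Sym2 V) => P ∈ openCluster (T ∩ E) s ∧ P ∉ openCluster (Tᶜ ∩ E) s ∧
          ∃ v, v ≠ s ∧ v ≠ P ∧ s(s, v) ∈ E ∧ s(s, v) ∈ T ∧ s(P, v) ∈ T) := by
      ext T
      simp only [D, Finset.mem_filter, Finset.mem_univ, true_and, Set.mem_singleton_iff, forall_eq]
      constructor
      · rintro ⟨⟨⟨v, hvs, hvP, hvE, h1, h2⟩, -⟩, hPY⟩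
        exact ⟨mem_red_of_rr hdom hvs hvP hvE h1 h2, hPY, v, hvs, hvP, hvE, h1, h2⟩
      · rintro ⟨-, hPY, v, hvs, hvP, hvE, h1, h2⟩
        exact ⟨⟨⟨v, hvs, hvP, hvE, h1, h2⟩, fun w hws hwP hwE => noBB_of_top hdom hPY hws hwP hwE⟩, hPY⟩
    rw [← hev]
    exact hfreeze
  · have hgT : good T := (Finset.mem_filter.1 hT).2
    refine ⟨⟨T ∩ A, Set.inter_subset_right, (hgood_iff T (T ∩ A) fun e he => ⟨fun h => h.1, fun h => ⟨h, he⟩⟩).1 hgT⟩,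
      fun e he => ⟨fun h => ⟨h, he⟩, fun h => h.1⟩⟩
  · exact Finset.mem_filter.2 ⟨Finset.mem_univ _, (hgood_iff c.1 T hT).1 c.2.2⟩
  · apply Subtype.ext
    ext e
    constructor
    · intro he
      exact (hc' e (c.2.1 he)).1 ((hc e (c.2.1 he)).2 he)
    · intro he
      exact (hc e (c'.2.1 he)).1 ((hc' e (c'.2.1 he)).2 he)
  · have hgT : good T := (hgood_iff c.1 T hT).1 c.2.2
    obtain ⟨⟨v, hvs, hvP, hvE, h1, h2⟩, hnoBB⟩ := hgT
    refine dom_of_agree hdom ∅ (fun e he => absurd he (Set.notMem_empty e)) (fun w => ?_) (fun w hws hwP hwE => ?_)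
      (fun e hse hPe _ => hflip e ?_) (mem_red_of_rr hdom hvs hvP hvE h1 h2) hnoBB
    · exact (hT' _ (hsA w)).trans (hT _ (hsA w)).symm
    · exact (hT' _ (hPA w hws hwP hwE)).trans (hT _ (hPA w hws hwP hwE)).symm
    · rintro (h | h)
      · exact hse h
      · exact hPe h

/-- **The cross part of the top event at a vertex dominating the source (`K`-form).** [this work] -/
theorem top_cross_sum_nonneg (E : Set (Sym2 V)) (s P : V) (hdom : ∀ v, v ≠ s → v ≠ P → s(s, v) ∈ E → s(P, v) ∈ E)
    {K₁ K₂ : Set V → Set V → ℝ}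
    (hK₁ : ∀ ⦃A A' B B' : Set V⦄, A ⊆ A' → B' ⊆ B → K₁ A B ≤ K₁ A' B') (hso₁ : ∀ A B, 0 ≤ K₁ A B + K₁ B A)
    (hK₂ : ∀ ⦃A A' B B' : Set V⦄, A ⊆ A' → B' ⊆ B → K₂ A B ≤ K₂ A' B') (hso₂ : ∀ A B, 0 ≤ K₂ A B + K₂ B A) :
    0 ≤ ∑ T ∈ Finset.univ.filter (fun T : Set (Sym2 V) => P ∈ openCluster (T ∩ E) s ∧ P ∉ openCluster (Tᶜ ∩ E) s ∧
        (∀ v, v ≠ s → v ≠ P → s(s, v) ∈ E → ¬ (s(s, v) ∈ T ∧ s(P, v) ∈ T)) ∧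
        ∃ j k, j ≠ s ∧ j ≠ P ∧ s(s, j) ∈ E ∧ k ≠ s ∧ k ≠ P ∧ s(s, k) ∈ E ∧ s(s, j) ∉ T ∧ s(s, k) ∈ T ∧ s(j, k) ∈ E ∧ s(j, k) ∈ T),
      K₁ (openCluster (T ∩ E) s) (openCluster (Tᶜ ∩ E) s) * K₂ (openCluster (T ∩ E) s) (openCluster (Tᶜ ∩ E) s) := by
  let nbr : V → Prop := fun v => v ≠ s ∧ v ≠ P ∧ s(s, v) ∈ E
  let A : Set (Sym2 V) := {e | s ∈ e ∨ ∃ v, v ≠ s ∧ v ≠ P ∧ s(s, v) ∈ E ∧ e = s(P, v)}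
  let cross : Set (Sym2 V) → Set (Sym2 V) := fun N =>
    {e | ∃ j k, e = s(j, k) ∧ nbr j ∧ nbr k ∧ s(s, j) ∉ N ∧ s(s, k) ∈ N}
  let Fix : Set (Sym2 V) → Set (Sym2 V) := fun N => A ∪ cross N
  let good : Set (Sym2 V) → Prop := fun N =>
    (∀ v, nbr v → (s(s, v) ∈ N ↔ s(P, v) ∉ N)) ∧
    (∃ j k, nbr j ∧ nbr k ∧ s(s, j) ∉ N ∧ s(s, k) ∈ N ∧ s(j, k) ∈ E ∧ s(j, k) ∈ N)
  have hsA : ∀ N v, s(s, v) ∈ Fix N := fun N v => Or.inl (Or.inl (Sym2.mem_mk_left s v))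
  have hPA : ∀ N v, nbr v → s(P, v) ∈ Fix N := fun N v hv => Or.inl (Or.inr ⟨v, hv.1, hv.2.1, hv.2.2, rfl⟩)
  have hcross_eq : ∀ N M : Set (Sym2 V), (∀ v, (s(s, v) ∈ M ↔ s(s, v) ∈ N)) → cross N = cross M := by
    intro N M h
    ext e
    simp only [cross, Set.mem_setOf_eq]
    constructor
    · rintro ⟨j, k, he, hj, hk, h1, h2⟩
      exact ⟨j, k, he, hj, hk, fun h' => h1 ((h j).1 h'), (h k).2 h2⟩
    · rintro ⟨j, k, he, hj, hk, h1, h2⟩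
      exact ⟨j, k, he, hj, hk, fun h' => h1 ((h j).2 h'), (h k).1 h2⟩
  have hFix_eq : ∀ N M : Set (Sym2 V), (∀ v, (s(s, v) ∈ M ↔ s(s, v) ∈ N)) → Fix N = Fix M := by
    intro N M h
    show A ∪ cross N = A ∪ cross M
    rw [hcross_eq N M h]
  have hgood_of : ∀ N M : Set (Sym2 V), (∀ e ∈ Fix N, (e ∈ M ↔ e ∈ N)) → good N → good M := by
    rintro N M h ⟨htype, j, k, hj, hk, h1, h2, h3, h4⟩
    refine ⟨fun v hv => ?_, j, k, hj, hk, fun h' => h1 ((h _ (hsA N j)).1 h'), (h _ (hsA N k)).2 h2, h3, ?_⟩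
    · rw [h _ (hsA N v), h _ (hPA N v hv)]
      exact htype v hv
    · have hjk : s(j, k) ∈ Fix N := Or.inr ⟨j, k, rfl, hj, hk, h1, h2⟩
      exact (h _ hjk).2 h4
  let C := {N : Set (Sym2 V) // N ⊆ Fix N ∧ good N}
  let D : Finset (Set (Sym2 V)) := Finset.univ.filter fun T => good T
  have hfreeze := Box.freeze_boxes_sum_nonneg E s D (fun c : C => Fix c.1) (fun c : C => c.1)
    (fun T hT => ?_) (fun c T hT => ?_) (fun c c' T hc hc' => ?_) (fun c T T' hT hT' hflip => ?_) {P} hK₁ hso₁ hK₂ hso₂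
  · have hev : D.filter (fun T => ∀ Q ∈ ({P} : Set V), Q ∉ openCluster (Tᶜ ∩ E) s) =
        Finset.univ.filter (fun T : Set (Sym2 V) => P ∈ openCluster (T ∩ E) s ∧ P ∉ openCluster (Tᶜ ∩ E) s ∧
          (∀ v, v ≠ s → v ≠ P → s(s, v) ∈ E → ¬ (s(s, v) ∈ T ∧ s(P, v) ∈ T)) ∧
          ∃ j k, j ≠ s ∧ j ≠ P ∧ s(s, j) ∈ E ∧ k ≠ s ∧ k ≠ P ∧ s(s, k) ∈ E ∧ s(s, j) ∉ T ∧ s(s, k) ∈ T ∧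
            s(j, k) ∈ E ∧ s(j, k) ∈ T) := by
      ext T
      simp only [D, Finset.mem_filter, Finset.mem_univ, true_and, Set.mem_singleton_iff, forall_eq]
      constructor
      · rintro ⟨⟨htype, j, k, hj, hk, h1, h2, h3, h4⟩, hPY⟩
        have hjk : j ≠ k := fun h => h1 (h ▸ h2)
        have hkX : k ∈ openCluster (T ∩ E) s := Twin.mem_red_of_pair (mem_openCluster_self _ s) h2 hk.2.2 hk.1.symm
        have hjX : j ∈ openCluster (T ∩ E) s :=
          Twin.mem_red_of_pair hkX (by rw [Sym2.eq_swap]; exact h4) (by rw [Sym2.eq_swap]; exact h3) hjk.symm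
        have hPj : s(P, j) ∈ T := by
          by_contra h
          exact h1 ((htype j hj).2 h)
        have hPX : P ∈ openCluster (T ∩ E) s :=
          Twin.mem_red_of_pair hjX (by rw [Sym2.eq_swap]; exact hPj) (by rw [Sym2.eq_swap]; exact hdom j hj.1 hj.2.1 hj.2.2) hj.2.1
        refine ⟨hPX, hPY, fun v hvs hvP hvE h => ?_, j, k, hj.1, hj.2.1, hj.2.2, hk.1, hk.2.1, hk.2.2, h1, h2, h3, h4⟩
        exact ((htype v ⟨hvs, hvP, hvE⟩).1 h.1) h.2
      · rintro ⟨-, hPY, hnoRR, j, k, hjs, hjP, hjE, hks, hkP, hkE, h1, h2, h3, h4⟩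
        refine ⟨⟨fun v hv => ⟨fun h h' => hnoRR v hv.1 hv.2.1 hv.2.2 ⟨h, h'⟩, fun h => ?_⟩, j, k, ⟨hjs, hjP, hjE⟩, ⟨hks, hkP, hkE⟩,
          h1, h2, h3, h4⟩, hPY⟩
        rcases noBB_of_top hdom hPY hv.1 hv.2.1 hv.2.2 with h' | h'
        · exact h'
        · exact absurd h' h
    rw [← hev]
    exact hfreeze
  · have hgT : good T := (Finset.mem_filter.1 hT).2
    have hFT : Fix (T ∩ Fix T) = Fix T :=
      (hFix_eq T (T ∩ Fix T) fun v => ⟨fun h => h.1, fun h => ⟨h, hsA T v⟩⟩).symm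
    refine ⟨⟨T ∩ Fix T, ?_, ?_⟩, fun e he => ?_⟩
    · rw [hFT]; exact Set.inter_subset_right
    · exact hgood_of T (T ∩ Fix T) (fun e he => ⟨fun h => h.1, fun h => ⟨h, he⟩⟩) hgT
    · change e ∈ Fix (T ∩ Fix T) at he
      rw [hFT] at he
      exact ⟨fun h => ⟨h, he⟩, fun h => h.1⟩
  · exact Finset.mem_filter.2 ⟨Finset.mem_univ _, hgood_of c.1 T hT c.2.2⟩
  · have hF : ∀ d : C, (∀ e ∈ Fix d.1, (e ∈ T ↔ e ∈ d.1)) → Fix d.1 = Fix T := fun d hd =>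
      hFix_eq d.1 T fun v => hd _ (hsA d.1 v)
    have hval : ∀ d : C, (∀ e ∈ Fix d.1, (e ∈ T ↔ e ∈ d.1)) → d.1 = T ∩ Fix T := by
      intro d hd
      ext e
      constructor
      · intro he
        have heF : e ∈ Fix d.1 := d.2.1 he
        exact ⟨(hd e heF).2 he, (hF d hd) ▸ heF⟩
      · rintro ⟨heT, heF⟩
        rw [← hF d hd] at heF
        exact (hd e heF).1 heT
    exact Subtype.ext ((hval c hc).trans (hval c' hc').symm)
  · have hgT : good T := hgood_of c.1 T hT c.2.2
    obtain ⟨htype, j₀, k₀, hj₀, hk₀, h1, h2, h3, h4⟩ := hgT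
    have hFc : Fix c.1 = Fix T := hFix_eq c.1 T fun v => hT _ (hsA c.1 v)
    -- `P ∈ X T` through `s – k₀ – j₀ – P`
    have hjk₀ : j₀ ≠ k₀ := fun h => h1 (h ▸ h2)
    have hk₀X : k₀ ∈ openCluster (T ∩ E) s := Twin.mem_red_of_pair (mem_openCluster_self _ s) h2 hk₀.2.2 hk₀.1.symm
    have hj₀X : j₀ ∈ openCluster (T ∩ E) s :=
      Twin.mem_red_of_pair hk₀X (by rw [Sym2.eq_swap]; exact h4) (by rw [Sym2.eq_swap]; exact h3) hjk₀.symm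
    have hPj₀ : s(P, j₀) ∈ T := by
      by_contra h
      exact h1 ((htype j₀ hj₀).2 h)
    have hPX : P ∈ openCluster (T ∩ E) s :=
      Twin.mem_red_of_pair hj₀X (by rw [Sym2.eq_swap]; exact hPj₀)
        (by rw [Sym2.eq_swap]; exact hdom j₀ hj₀.1 hj₀.2.1 hj₀.2.2) hj₀.2.1
    have hnoBB : ∀ v, v ≠ s → v ≠ P → s(s, v) ∈ E → s(s, v) ∈ T ∨ s(P, v) ∈ T := by
      intro v hvs hvP hvE
      by_cases h : s(s, v) ∈ T
      · exact Or.inl h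
      · exact Or.inr (by by_contra h'; exact h ((htype v ⟨hvs, hvP, hvE⟩).2 h'))
    refine dom_of_agree hdom (cross T) (fun e he => ?_) (fun w => ?_) (fun w hws hwP hwE => ?_)
      (fun e hse hPe hCe => hflip e ?_) hPX hnoBB
    · obtain ⟨j, k, hejk, hj, hk, -, -⟩ := he
      exact ⟨j, k, hejk, hj.1, hj.2.1, hj.2.2, hk.1, hk.2.1, hk.2.2⟩
    · exact (hT' _ (hsA c.1 w)).trans (hT _ (hsA c.1 w)).symm
    · exact (hT' _ (hPA c.1 w ⟨hws, hwP, hwE⟩)).trans (hT _ (hPA c.1 w ⟨hws, hwP, hwE⟩)).symm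
    · intro heF
      rw [hFc] at heF
      rcases heF with (h | h) | h
      · exact hse h
      · exact hPe h
      · exact hCe h

end Dom

end Antithetic

end Summit.CriticalPhenomena.PercolationContinuityZ3.Theorems
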